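import Summits.QuantumFields.YangMills.Theorems.BalabanUVNodesPortZDRecordGaugeOn

/-!
# NODE O port, row PT-A′ (PTZ-1, gen 2): the (1.19) ∕ (2.16) row of the HISTORY CHANNEL `𝓓_{k+1} = 𝓝_{k+1} − 𝓝⁰_{k+1}` (the (L) slot `Φf − Φz` by name,
# `PortZDRecord.recordΦfAx_sub_recordΦzAx`) ON THE DOMAIN over the canonical transport of record — BOTH transport image clauses of gen 0's
# `PortZD.dChannel_gaugeAct_on` DISCHARGED; generic, then at the Ax record on the [15] Thm 1 domain

[Balaban1987RG1] = [I] (CMP 109, 1987): (2.16) p. 269, p. 263 («the action A_k(U) defined on the space U_k(ε₀) … is gauge invariant»), (1.19) p. 263, (0.13) p. 254,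
(1.6) p. 261; [Balaban1985Variational] = [15]: Thm 1 p. 279, (181) p. 307.

Seat `ymgap-nodeO-port-PTZ-1` g2 (prover, HELPER MODE; `--supports stmt-QuantumFields-26648 --as helper`; NO `--workitem`).  Companion of gen 0's `…PortZDStepRowsOn`
(✓p798857: `dChannel_gaugeAct_on` with the two image clauses `hTon`, `hTon₀` and the on-domain invariance of `A_k` DISPLAYED) and gen 2's `…PortZDTransportGaugeOn`
(✓p802566: the image clause over the canonical transport from lift-invariance over an open gauge-stable set) ∕ `…PortZDRecordGaugeOn` (the record's cut-off is
lift-invariant over the [15] Thm 1 domain).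

WHAT IS PROVED (0 sorry; no `def` ∕ `instance` ∕ `notation`):
* §1 (generic, ns `…PortZD`) `integrand_effActionHT_liftInvariantOn` — the FULL-input (0.19) density `χ_k e^{−GF_k∕g_k² + A_k}` is lift-invariant over `D` as soon as
  `χ_k` is, `A_k` is invariant on a level-k set `Dₖ` under all level-k gauge transformations (N09 MODULE 5's output shape `invOn_effActionHT_of_stepsOn`, DISPLAYED)
  and `supp χ_k ∩ avg⁻¹ D ⊆ Dₖ` (off `Dₖ` both sides vanish); ★★ `dChannel_gaugeAct_on_Tcan` — `𝓓_{k+1}(W^v) = 𝓓_{k+1}(W)` for `W ∈ D ∩ regSet(full) ∩ regSet(zero-input)`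
  with BOTH image clauses discharged (`PortZD.TcanOfRecord_gaugeAct_of_liftInvariantOn`), the remaining binders being gen 0's: `Dₖ` gauge-stable, `A_k` invariant on
  `Dₖ`, the nesting `Ū^k U_{k+1}(W) ∈ Dₖ`, the [B11] clauses at `W` ∕ `W^v`, integrability ×2.
* §2 (record, ns `…PortZDRecord`) ★★ `recordChannel_gaugeAct_on_of_tokE` — the same at the Ax record (`θ := thetaFill F a₀ ε₂₉`, `T := TβOfRecord₁₃`, `χ := chiβOfRecord₁₃Ax θ`,
  `ε := a₀`) on `D := {PlaqSmall ε₁}` under TokE (the cut-off's lift-invariance over `D` supplied by `chiβOfRecord₁₃Ax_liftInvariantOn_of_tokE`, the [B11] clauses at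
  `W`, `W^v` read off TokE); `A_k`'s on-domain invariance, the nesting, integrability ×2 and `regSet` ×2 stay DISPLAYED.
HONEST FRAMING.  Bookkeeping; NOTHING of Bałaban's estimates asserted, ported or discharged; the displayed binders are exactly print's p. 263 sentence + [15] Thm 1 +
K0e's (F1)–(F3) and are not discharged here; 26648 ∕ 27930⁸ SIGNED·OPEN (content-gated), 27931 under CLOSE HOLD, 27932 CLOSED; counts unmoved; finite 𝕋⁴ at fixed ε —
NOT continuum ∕ OS ∕ Clay; the Yang–Mills mass gap is NOT proved by any of this.
-/

noncomputable section

open MeasureTheory Set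

namespace Summit.QuantumFields.YangMills.Theorems.PortZD

open Literature.MathematicalPhysics.QuantumFieldTheory.Balaban1983to89
open Literature.MathematicalPhysics.QuantumFieldTheory.Balaban1983to89.Node00
open Literature.MathematicalPhysics.QuantumFieldTheory.Balaban1983to89.T4Continuum (T4Family)
open B12Eq019ActionBody (integrand integrand_apply)
open B12RTGaugeInvariance254 (liftTransf)
open B12EffectiveActionInvarianceT (gfOfRecord_liftInvariant)
open GaugeField (gaugeAct)

variable {F : T4Family} {N : ℕ} [NeZero N]

/-! ## §1. Generic: the history channel on the domain over the canonical transport, image clauses discharged -/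

/-- The FULL-input (0.19) density `χ_k e^{−GF_k∕g_k² + A_k}` is lift-invariant over `D` when `χ_k` is, `A_k` is invariant on a level-k set `Dₖ` under all level-k gauge
transformations, and `supp χ_k ∩ avg⁻¹ D ⊆ Dₖ` (off `Dₖ` the cut-off kills both sides). [cite: Balaban1987RG1, (0.19) p.255 and p.263] -/
theorem integrand_effActionHT_liftInvariantOn (T : Transport F N) (χ : (K : ℕ) → (ℕ → ℝ) → (k : ℕ) → Density (F.P K) k (SU N)) {K : ℕ}
    (g : ℕ → ℝ) {k : ℕ} (hk : k + 1 ≤ (F.P K).m + (F.P K).K) {D : Set (PBond (F.P K) (k + 1) → SU N)} {Dk : Set (GaugeField (F.P K) k (SU N))}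
    (hχ : ∀ (v : GaugeTransf (F.P K) (k + 1) (SU N)) (V : GaugeField (F.P K) k (SU N)), (avOfRecord F N K k).avg V ∈ D →
      χ K g k (gaugeAct (liftTransf v) V) = χ K g k V)
    (hAon : ∀ (w : GaugeTransf (F.P K) k (SU N)) (U : GaugeField (F.P K) k (SU N)), U ∈ Dk →
      effActionHT F N T χ K g k (gaugeAct w U) = effActionHT F N T χ K g k U)
    (hsupp : ∀ V : GaugeField (F.P K) k (SU N), (avOfRecord F N K k).avg V ∈ D → χ K g k V ≠ 0 → V ∈ Dk)
    (v : GaugeTransf (F.P K) (k + 1) (SU N)) (V : GaugeField (F.P K) k (SU N)) (hV : (avOfRecord F N K k).avg V ∈ D) :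
    integrand (χ K g k) (gfOfRecord F N K k) (g k) (effActionHT F N T χ K g k) (gaugeAct (liftTransf v) V) =
      integrand (χ K g k) (gfOfRecord F N K k) (g k) (effActionHT F N T χ K g k) V := by
  rw [integrand_apply, integrand_apply, hχ v V hV, gfOfRecord_liftInvariant F N K hk v V]
  by_cases h0 : χ K g k V = 0
  · rw [h0, zero_mul, zero_mul]
  · rw [hAon (liftTransf v) V (hsupp V hV h0)]

/-- ★★ **THE HISTORY CHANNEL ON THE DOMAIN OVER THE CANONICAL TRANSPORT, BOTH IMAGE CLAUSES DISCHARGED**: `𝓓_{k+1}(W^v) = 𝓓_{k+1}(W)` for every coarse `v` and every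
`W ∈ D ∩ regSet(χ_k e^{−GF∕g² + A_k}) ∩ regSet(χ_k e^{−GF∕g² + A⁰_k})` (`D` open, gauge-stable; `k < K`), given: `χ_k` lift-invariant over `D`; `A_k` invariant on the level-k
gauge-stable set `Dₖ` with `supp χ_k ∩ avg⁻¹ D ⊆ Dₖ` and the nesting `Ū^k U_{k+1}(W) ∈ Dₖ`; the [B11] clauses at `W`, `W^v`; both densities integrable.
[cite: Balaban1987RG1, (2.16) p.269, (1.19) p.263, (1.6) p.261, (0.13) p.254; Balaban1985Variational, (181) p.307] -/
theorem dChannel_gaugeAct_on_Tcan (χ : (K : ℕ) → (ℕ → ℝ) → (k : ℕ) → Density (F.P K) k (SU N)) (ε : ℝ) {K : ℕ} (g : ℕ → ℝ) {k : ℕ}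
    (hk : k < K) {D : Set (PBond (F.P K) (k + 1) → SU N)} (hDo : IsOpen D)
    (hDst : ∀ (v : GaugeTransf (F.P K) (k + 1) (SU N)) (V : GaugeField (F.P K) (k + 1) (SU N)), V ∈ D → gaugeAct v V ∈ D)
    {Dk : Set (GaugeField (F.P K) k (SU N))}
    (hDkst : ∀ (w : GaugeTransf (F.P K) k (SU N)) (U : GaugeField (F.P K) k (SU N)), U ∈ Dk → gaugeAct w U ∈ Dk)
    (hχ : ∀ (v : GaugeTransf (F.P K) (k + 1) (SU N)) (V : GaugeField (F.P K) k (SU N)), (avOfRecord F N K k).avg V ∈ D →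
      χ K g k (gaugeAct (liftTransf v) V) = χ K g k V)
    (hAon : ∀ (w : GaugeTransf (F.P K) k (SU N)) (U : GaugeField (F.P K) k (SU N)), U ∈ Dk →
      effActionHT F N (TcanOfRecord F N) χ K g k (gaugeAct w U) = effActionHT F N (TcanOfRecord F N) χ K g k U)
    (hsupp : ∀ V : GaugeField (F.P K) k (SU N), (avOfRecord F N K k).avg V ∈ D → χ K g k V ≠ 0 → V ∈ Dk)
    (hρ : Integrable (integrand (χ K g k) (gfOfRecord F N K k) (g k) (effActionHT F N (TcanOfRecord F N) χ K g k))
      (fieldMeasure (F.P K) k (SU N)))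
    (hρ₀ : Integrable (integrand (χ K g k) (gfOfRecord F N K k) (g k) (ZeroInput.mainTermT F N ε K g k)) (fieldMeasure (F.P K) k (SU N)))
    (v : GaugeTransf (F.P K) (k + 1) (SU N)) {W : GaugeField (F.P K) (k + 1) (SU N)} (hWD : W ∈ D)
    (hWreg : (W : PBond (F.P K) (k + 1) → SU N) ∈ regSetOfRecord F N K k
      (integrand (χ K g k) (gfOfRecord F N K k) (g k) (effActionHT F N (TcanOfRecord F N) χ K g k)))
    (hWreg₀ : (W : PBond (F.P K) (k + 1) → SU N) ∈ regSetOfRecord F N K k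
      (integrand (χ K g k) (gfOfRecord F N K k) (g k) (ZeroInput.mainTermT F N ε K g k)))
    (hnest : Averaging.iter (avOfRecord F N K) k (Uk F N K (k + 1) ε W) ∈ Dk)
    (hW : UkExists F N K (k + 1) ε W) (hu : UniqueUkOrbit F N K (k + 1) ε (gaugeAct v W)) :
    mergedTermT F N (TcanOfRecord F N) χ ε K g k (gaugeAct v W) - ZeroInput.zeroInputMergedTermT F N (TcanOfRecord F N) χ ε K g k (gaugeAct v W) =
      mergedTermT F N (TcanOfRecord F N) χ ε K g k W - ZeroInput.zeroInputMergedTermT F N (TcanOfRecord F N) χ ε K g k W := by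
  have hk' : k + 1 ≤ (F.P K).m + (F.P K).K := by simp only [T4Continuum.T4Family.P_K]; omega
  -- the set on which both canonical transports are pointwise determined
  set D' : Set (GaugeField (F.P K) (k + 1) (SU N)) := {V | V ∈ D ∧
    (V : PBond (F.P K) (k + 1) → SU N) ∈ regSetOfRecord F N K k
      (integrand (χ K g k) (gfOfRecord F N K k) (g k) (effActionHT F N (TcanOfRecord F N) χ K g k)) ∧
    (V : PBond (F.P K) (k + 1) → SU N) ∈ regSetOfRecord F N K k
      (integrand (χ K g k) (gfOfRecord F N K k) (g k) (ZeroInput.mainTermT F N ε K g k))} with hD'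
  have hTon : ∀ (v : GaugeTransf (F.P K) (k + 1) (SU N)) (V : GaugeField (F.P K) (k + 1) (SU N)), V ∈ D' →
      TcanOfRecord F N K k (integrand (χ K g k) (gfOfRecord F N K k) (g k) (effActionHT F N (TcanOfRecord F N) χ K g k)) (gaugeAct v V) =
        TcanOfRecord F N K k (integrand (χ K g k) (gfOfRecord F N K k) (g k) (effActionHT F N (TcanOfRecord F N) χ K g k)) V :=
    fun v V hV => (TcanOfRecord_gaugeAct_of_liftInvariantOn hk hρ hDo hDst
      (integrand_effActionHT_liftInvariantOn (TcanOfRecord F N) χ g hk' hχ hAon hsupp) v ⟨hV.1, hV.2.1⟩).1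
  have hTon₀ : ∀ (v : GaugeTransf (F.P K) (k + 1) (SU N)) (V : GaugeField (F.P K) (k + 1) (SU N)), V ∈ D' →
      TcanOfRecord F N K k (integrand (χ K g k) (gfOfRecord F N K k) (g k) (ZeroInput.mainTermT F N ε K g k)) (gaugeAct v V) =
        TcanOfRecord F N K k (integrand (χ K g k) (gfOfRecord F N K k) (g k) (ZeroInput.mainTermT F N ε K g k)) V :=
    fun v V hV => (TcanOfRecord_gaugeAct_of_liftInvariantOn hk hρ₀ hDo hDst
      (integrand_mainTermT_liftInvariantOn χ ε g hk' hχ) v ⟨hV.1, hV.2.2⟩).1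
  exact dChannel_gaugeAct_on F N (TcanOfRecord F N) χ ε g hk' (D := Dk) (D' := D') hTon hTon₀ hDkst hAon v ⟨hWD, hWreg, hWreg₀⟩ hnest hW hu

end Summit.QuantumFields.YangMills.Theorems.PortZD

namespace Summit.QuantumFields.YangMills.Theorems.PortZDRecord

open Literature.MathematicalPhysics.QuantumFieldTheory.Balaban1983to89
open Literature.MathematicalPhysics.QuantumFieldTheory.Balaban1983to89.Node00
open Literature.MathematicalPhysics.QuantumFieldTheory.Balaban1983to89.T4Continuum (T4Family)
open Summit.QuantumFields.YangMills.Theorems.K0RecordFormatNames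
open B12Eq019ActionBody (integrand)
open GaugeField (gaugeAct)

variable (F : T4Family) (a₀ ε₂₉ : ℝ)

/-! ## §2. At the Ax record on the [15] Thm 1 domain -/

/-- ★★ **(2.16) FOR THE HISTORY CHANNEL OF RECORD ON THE [15] Thm 1 DOMAIN, OVER THE CANONICAL TRANSPORT, IMAGE CLAUSES DISCHARGED**: `θ := thetaFill F a₀ ε₂₉`
(`T := TβOfRecord₁₃`, `χ := chiβOfRecord₁₃Ax θ`, `ε := θ.εbg = a₀`), `k < K`, TokE at `(K, k+1, a₀, ε₁)`; DISPLAYED: `A_k` invariant on a level-k gauge-stable `Dₖ` containing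
`supp χ_k ∩ avg⁻¹{PlaqSmall ε₁}` and the nesting point `Ū^k U_{k+1}(W)`, integrability ×2, `regSet` ×2.  Then `𝓓_{k+1}(W^v) = 𝓓_{k+1}(W)` for every small-field `W`.
[cite: Balaban1987RG1, (2.16) p.269, p.263, (1.6) p.261; Balaban1985Variational, Thm 1 p.279, (181) p.307] -/
theorem recordChannel_gaugeAct_on_of_tokE {K k : ℕ} (hk : k < K) {ε₁ : ℝ} (g : ℕ → ℝ)
    (hTokE : ∀ V : GaugeField (F.P K) (k + 1) (SU 2), PlaqSmall ε₁ V → UkExists F 2 K (k + 1) a₀ V ∧ UniqueUkOrbit F 2 K (k + 1) a₀ V)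
    {Dk : Set (GaugeField (F.P K) k (SU 2))}
    (hDkst : ∀ (w : GaugeTransf (F.P K) k (SU 2)) (U : GaugeField (F.P K) k (SU 2)), U ∈ Dk → gaugeAct w U ∈ Dk)
    (hAon : ∀ (w : GaugeTransf (F.P K) k (SU 2)) (U : GaugeField (F.P K) k (SU 2)), U ∈ Dk →
      effActionHT F 2 (TβOfRecord₁₃ F 2) (chiβOfRecord₁₃Ax F 2 (thetaFill F a₀ ε₂₉)) K g k (gaugeAct w U) =
        effActionHT F 2 (TβOfRecord₁₃ F 2) (chiβOfRecord₁₃Ax F 2 (thetaFill F a₀ ε₂₉)) K g k U)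
    (hsupp : ∀ V : GaugeField (F.P K) k (SU 2), PlaqSmall ε₁ ((avOfRecord F 2 K k).avg V) →
      chiβOfRecord₁₃Ax F 2 (thetaFill F a₀ ε₂₉) K g k V ≠ 0 → V ∈ Dk)
    (hρ : Integrable (integrand (chiβOfRecord₁₃Ax F 2 (thetaFill F a₀ ε₂₉) K g k) (gfOfRecord F 2 K k) (g k)
      (effActionHT F 2 (TβOfRecord₁₃ F 2) (chiβOfRecord₁₃Ax F 2 (thetaFill F a₀ ε₂₉)) K g k)) (fieldMeasure (F.P K) k (SU 2)))
    (hρ₀ : Integrable (integrand (chiβOfRecord₁₃Ax F 2 (thetaFill F a₀ ε₂₉) K g k) (gfOfRecord F 2 K k) (g k)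
      (ZeroInput.mainTermT F 2 (thetaFill F a₀ ε₂₉).εbg K g k)) (fieldMeasure (F.P K) k (SU 2)))
    (v : GaugeTransf (F.P K) (k + 1) (SU 2)) {W : GaugeField (F.P K) (k + 1) (SU 2)} (hWs : PlaqSmall ε₁ W)
    (hWreg : (W : PBond (F.P K) (k + 1) → SU 2) ∈ regSetOfRecord F 2 K k
      (integrand (chiβOfRecord₁₃Ax F 2 (thetaFill F a₀ ε₂₉) K g k) (gfOfRecord F 2 K k) (g k)
        (effActionHT F 2 (TβOfRecord₁₃ F 2) (chiβOfRecord₁₃Ax F 2 (thetaFill F a₀ ε₂₉)) K g k)))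
    (hWreg₀ : (W : PBond (F.P K) (k + 1) → SU 2) ∈ regSetOfRecord F 2 K k
      (integrand (chiβOfRecord₁₃Ax F 2 (thetaFill F a₀ ε₂₉) K g k) (gfOfRecord F 2 K k) (g k)
        (ZeroInput.mainTermT F 2 (thetaFill F a₀ ε₂₉).εbg K g k)))
    (hnest : Averaging.iter (avOfRecord F 2 K) k (Uk F 2 K (k + 1) a₀ W) ∈ Dk) :
    mergedTermT F 2 (TβOfRecord₁₃ F 2) (chiβOfRecord₁₃Ax F 2 (thetaFill F a₀ ε₂₉)) (thetaFill F a₀ ε₂₉).εbg K g k (gaugeAct v W) -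
        ZeroInput.zeroInputMergedTermT F 2 (TβOfRecord₁₃ F 2) (chiβOfRecord₁₃Ax F 2 (thetaFill F a₀ ε₂₉)) (thetaFill F a₀ ε₂₉).εbg K g k
          (gaugeAct v W) =
      mergedTermT F 2 (TβOfRecord₁₃ F 2) (chiβOfRecord₁₃Ax F 2 (thetaFill F a₀ ε₂₉)) (thetaFill F a₀ ε₂₉).εbg K g k W -
        ZeroInput.zeroInputMergedTermT F 2 (TβOfRecord₁₃ F 2) (chiβOfRecord₁₃Ax F 2 (thetaFill F a₀ ε₂₉)) (thetaFill F a₀ ε₂₉).εbg K g k W := by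
  have hk' : k + 1 ≤ (F.P K).m + (F.P K).K := by simp only [T4Continuum.T4Family.P_K]; omega
  have hDo : IsOpen {W : PBond (F.P K) (k + 1) → SU 2 | PlaqSmall ε₁ W} := isOpen_plaqSmall (P := F.P K) (j := k + 1) (N := 2) ε₁
  have hDst : ∀ (v : GaugeTransf (F.P K) (k + 1) (SU 2)) (V : GaugeField (F.P K) (k + 1) (SU 2)),
      V ∈ {W : PBond (F.P K) (k + 1) → SU 2 | PlaqSmall ε₁ W} → gaugeAct v V ∈ {W : PBond (F.P K) (k + 1) → SU 2 | PlaqSmall ε₁ W} :=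
    fun v V hV => (B12GaugeOrbits021.plaqSmall_gaugeAct_iff' ε₁ v V).2 hV
  have hTokE' : ∀ V : GaugeField (F.P K) (k + 1) (SU 2), PlaqSmall ε₁ V →
      UkExists F 2 K (k + 1) (thetaFill F a₀ ε₂₉).ν.εreg V ∧ UniqueUkOrbit F 2 K (k + 1) (thetaFill F a₀ ε₂₉).ν.εreg V := hTokE
  exact PortZD.dChannel_gaugeAct_on_Tcan (N := 2) (chiβOfRecord₁₃Ax F 2 (thetaFill F a₀ ε₂₉)) (thetaFill F a₀ ε₂₉).εbg g hk hDo hDst hDkst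
    (fun v V hV => chiβOfRecord₁₃Ax_liftInvariantOn_of_tokE F (thetaFill F a₀ ε₂₉) hk' hTokE' g v V hV) hAon
    (fun V hV hχ => hsupp V hV hχ) hρ hρ₀ v hWs hWreg hWreg₀ hnest (hTokE W hWs).1
    (hTokE _ ((B12GaugeOrbits021.plaqSmall_gaugeAct_iff' ε₁ v W).2 hWs)).2

end Summit.QuantumFields.YangMills.Theorems.PortZDRecord

end
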